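import Literature.NumberTheory.QuadraticFields.RedeiMatrixFourRank
import Literature.NumberTheory.EllipticCurves.Rank1Residual.X11RankOneCertificates.Schema
import Mathlib.Data.Matrix.Block
import HarnessLib

/-!
# The CM corner at `p = 2` in analytic rank one (leaf `CornerF @ 2`) — per-member certificate records: the record schema and its in-kernel recheck

HONEST FRAMING (cell `bsd-print-cf2`, run/shared/lean/pub/bsd-print-cf2/, D-0131 (2) PRINT TIER, seat
ty3): the leaf of record is `CornerF W 2` — `W/ℚ` with complex multiplication, analytic rank `1`, the
prime `2` (`Rank1Residual.CornerF`; at `2` the sharp corner `CornerFSharp W 2`: CM, `r_an = 1`, `2` not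
good ordinary). It is OPEN AS A CLASS; PRINT closes sub-FAMILIES by name (Li–Liu–Tian 2024 Thm. 1.2 for
`E_n : y² = x³ − n²x`), settles one side in others (Tian 2014 Thm. 1.3: `Ш(E_m)[2^∞] = 0`; Hu–Shu–Yin
2019 / Dasgupta–Voight 2018: the ODD parts for `E_p : x³ + y³ = p`), and leaves `BSD(E,2)` open
elsewhere. The census lists NO pairs in this leaf (its ledger is odd-prime), so the unit of data is a
MEMBER of an explicit infinite print family. This file fixes the FORMAT in which per-member hypothesis
certificates enter the tree as DATA (one record per member; the sibling display files `Records*.lean`,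
one per family, state `Certified [r₁, …]` proved by `decide`, the kernel re-running `Record.check` on the
literal data). Nothing here is a named fact and nothing is asserted about elliptic curves: what a record
CLAIMS about its curve is `Record.Claim` of the sibling `Claim.lean` (a `Prop` taken as a hypothesis,
D-0014 style), which also proves which PUBLISHED named facts turn a certified record into Miller's
`BSD(E,2)` (Li–Liu–Tian members: the single fact `LiLiuTian2024.thm12_bsd_congruentNumberCurve`,
Rédei–Reichardt being a tree THEOREM) and which printed hypotheses a certified record DISCHARGES for the
other families. Pattern: the tree's `X11RankOneCertificates/{Schema, Claim, Records*}` (whose kernel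
arithmetic `powMod`, `natVal`, `isPrimeBelow504100` is REUSED) and the tree's
computable Rédei matrix `RedeiReichardt.redeiMatrix` / `kroneckerBit` (Li–Ma 2008 orientation, p319707).

## The families (tag `Record.family`) and what print gives at `2`

* `congruentLLT` — `E_n`, `n ≡ 5 (mod 8)` square-free, every prime factor `≡ 1 (mod 4)`, `Cl(ℚ(√−n))`
  without element of order `4`: Li–Liu–Tian 2024 Thm. 1.2 ⇒ rank `= r_an = 1` and FULL BSD, hence
  `BSD(E_n, 2)` — the leaf pair CLOSED BY NAME. [cite: LiLiuTian2024, Thm. 1.2]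
* `congruentTian` — `E_m`, `m ∈ {n, 2n} ≡ 5, 6, 7 (mod 8)`, `n = p₀p₁⋯p_k` odd, `pᵢ ≡ 1 (mod 8)` (`i ≥ 1`),
  condition (1.1) on `Cl(ℚ(√−2n))` (`4`-rank `0` if `n ≡ ±3 (mod 8)`, `1` otherwise): Tian 2014 Thm. 1.3
  ⇒ rank `= r_an = 1`, `Ш` finite of ODD order; `BSD(E_m,2)` ⟺ `ord₂ #Ш_an = 0` (a numeric column; NOT
  claimed in print, Rem. 1.4). [cite: Tian2014, Thm. 1.3 and Rem. 1.4]
* `sylvester` / `sylvesterSq` — `E_p : x³ + y³ = p` / `E_{p²}`, `p ≡ 4, 7 (mod 9)` prime, `3` not a cube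
  mod `p`: rank `1` (Dasgupta–Voight Thm. 2), `r_an(E_p) = 1` and the `3`-part (Hu–Shu–Yin Thm. 1.3/1.4);
  `BSD(E_p, 2)` OPEN in print (loc. cit. p. 3). [cite: HuShuYin2019, Thm. 1.3 and Thm. 1.4] [cite: DasguptaVoight2018, Thm. 2]
* `cubeSumTwoP` (`2p`, `p ≡ 2`; `2p²`, `p ≡ 5 (mod 9)`: Kezuka–Li 2020 Cor. 1.2), `cubeSumThreeP` (`3p²`,
  `p ≡ 2`; `3p`, `p ≡ 5`: Shu–Yin 2022 Thm. 1.2): rank one, `3`-part in print, `BSD(E,2)` open.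
  [cite: KezukaLi2020, Cor. 1.2] [cite: ShuYin2022, Thm. 1.2]
All members are CM (`j = 1728`, `2` ramified in `ℚ(i)`; resp. `j = 0`, `2` inert in `ℚ(√−3)`) of
analytic rank `1`: leaf `CornerF @ 2`.

## What a record records, and what the kernel rechecks (`Record.check`, decidable)

* `param`, `primes` (the distinct primes of `param`). RECHECKED: primality (trial division,
  `< 504100`), no duplicates, the family's SHAPE of `param` in them (`∏ primes`; `p`, `p²`, `2p^j`,
  `3p^j`) and the printed residue conditions (`n % 8`, `q % 4 = 1`, `pᵢ ≡ 1 (mod 8)` for `i ≥ 1`, `p % 9`).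
* `ainvs`, `conductor`. RECHECKED where the model is a tree definition: `[0,0,0,−n²,0]`
  (`congruentNumberCurve n`, `N = 32n²` / `16n²`), `[0,0,p,0,−7p²]` (`X12.sylvesterCurve p`; `N` engine output).
* `r4` = `4`-rank of `Cl(ℚ(√−n))`, `r4two` = `4`-rank of `Cl(ℚ(√−2n₀))` (`n₀` the odd part; congruent
  families). RECHECKED: the kernel of the tree's Rédei matrix on the prime tuple of the discriminant has
  `2^{r4+1}` resp. `2^{r4two+1}` elements (Rédei–Reichardt, `#ker = 2·2^{r₄}`:
  `RedeiReichardt.card_ker_redeiMatrix_eq_two_mul_fourTwoCard`) — "no ideal class of order `4`" and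
  Tian's (1.1) are KERNEL facts, not engine output.
* `sel2` = `s` with `#Sel₂(E) = 2^{dim E(ℚ)[2] + s}` (Heath-Brown's `s(D)`). RECHECKED (congruent
  families): the kernel of Monsky's matrix (entries by Euler's criterion, `kroneckerBit` — the bits of
  the tree's `HeathBrown1994.monskyMatrixOdd/Even`, there written with `jacobiSym`) has `2^{sel2}` elements.
* `cubicBit` (Sylvester families): RECHECKED `3^{(p−1)/3} ≢ 1 (mod p)` (⇒ `3` not a cube mod `p`).
* `rankMW`, `rankAn`, `rootNumber`, `torsion`, `tamagawa`, `shaAn` (analytic order of `Ш`, an integer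
  agreed by the engines), `ord2ShaAn`, `sha2` (`dim Ш[2]` from descent), `ord2Heegner` (`v₂` of a Heegner
  index where pinned), `digits`, `engines`: the TWO-ENGINE numeric columns (P = PARI/GP `ellanalyticrank`,
  `ellrank`, `ellheight`, `ellbsd`; S = SageMath native `lseries`, `period_lattice`, eclib two-descent,
  heights; kit jobs named per record). RECHECKED for consistency only: `rankAn = rankMW = 1`,
  `rootNumber = −1` (the leaf), `ord2ShaAn = v₂(shaAn)`, `shaAn` a positive square, `sel2 = rankMW + sha2`,
  two engines, `digits ≥ 1`; AGAINST PRINT: `sha2 = 0` on both congruent families (`Ш` odd),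
  `ord2ShaAn = 0` on `congruentLLT` (full BSD).

NOT checked here (CLAIMS about the curve, `Claim.lean`): the ranks, `#Ш_an`, the Selmer group itself,
the Heegner index — and not `BSD(E,2)` outside `congruentLLT`.

## Design

Plain computable data; `decide` (kernel) runs the recheck; no `instance` is declared (`Certified` is an
`abbrev` of a `Bool` equation); no `native_decide`. References: [LiLiuTian2024] Thm. 1.2; [Tian2014]
Thm. 1.3, (1.1), Rem. 1.4; [LiMa2008] Thm. 0.4; [HeathBrown1994SelmerCongruentII] appendix (Monsky);
[HuShuYin2019] Thm. 1.3/1.4, p. 3; [DasguptaVoight2018] Thm. 2; [KezukaLi2020] Cor. 1.2; [ShuYin2022]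
Thm. 1.2; [Miller2011LMS] Def. 1.1; HOME/STATUS.md (ty3 lines); kit jobs j278947 (P), j278949 (S).
-/

open Matrix
open Literature.NumberTheory.QuadraticFields.RedeiReichardt (kroneckerBit redeiMatrix)
open Literature.NumberTheory.EllipticCurves.Rank1Residual.X11RankOneCertificates
  (powMod natVal isPrimeBelow504100)

namespace Literature.NumberTheory.EllipticCurves.Rank1Residual.CornerFTwoCertificates

/-- The print families of the leaf `CornerF @ 2` a record may belong to (module docstring, §families).
[cite: LiLiuTian2024, Thm. 1.2] [cite: Tian2014, Thm. 1.3] [cite: HuShuYin2019, Thm. 1.3 and Thm. 1.4]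
[cite: KezukaLi2020, Cor. 1.2] [cite: ShuYin2022, Thm. 1.2] -/
inductive Family
  /-- `E_n : y² = x³ − n²x` in the Li–Liu–Tian 2024 Thm. 1.2 family (BSD(E_n,2) closed by name). -/
  | congruentLLT
  /-- `E_m`, `m ∈ {n, 2n} ≡ 5,6,7 (mod 8)` in the Tian 2014 Thm. 1.3 family (Ш(E_m)[2^∞] = 0 by name). -/
  | congruentTian
  /-- `E_p : x³ + y³ = p`, `p ≡ 4,7 (mod 9)` prime, `3` not a cube mod `p` (Hu–Shu–Yin / Dasgupta–Voight). -/
  | sylvester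
  /-- `E_{p²} : x³ + y³ = p²`, same `p` (Dasgupta–Voight 2018 Thm. 2). -/
  | sylvesterSq
  /-- `x³ + y³ = 2p` (`p ≡ 2 mod 9`) or `2p²` (`p ≡ 5 mod 9`) (Kezuka–Li 2020 Cor. 1.2). -/
  | cubeSumTwoP
  /-- `x³ + y³ = 3p²` (`p ≡ 2 mod 9`) or `3p` (`p ≡ 5 mod 9`) (Shu–Yin 2022 Thm. 1.2). -/
  | cubeSumThreeP
  deriving DecidableEq, Repr

/-- Is the family one of the two congruent-number families (`j = 1728`)? [folklore] -/
def Family.isCongruent : Family → Bool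
  | .congruentLLT => true
  | .congruentTian => true
  | _ => false

/-- One certificate record of the leaf `CornerF @ 2`: the DATA of one member of a print family (see the
module docstring for the meaning of each field). A record asserts nothing by itself; `Record.check` is
its decidable recheck; the fields are the printed hypotheses of the family theorems and Miller's
`BSD(E,2)` bookkeeping. [cite: LiLiuTian2024, Thm. 1.2 (hypotheses)] [cite: Tian2014, Thm. 1.3 (hypotheses)]
[cite: Miller2011LMS, Def. 1.1] -/
structure Record where
  /-- the print family. -/
  family : Family
  /-- the parameter: `n` of `E_n : y² = x³ − n²x`, resp. `n` of `x³ + y³ = n`. -/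
  param : ℕ
  /-- the distinct primes dividing `param` (`2` first if present; then increasing, resp. Tian's order `p₀, p₁, …`). -/
  primes : List ℕ
  /-- LMFDB / Cremona label of the curve when inside a database range (documentation; `""` otherwise). -/
  label : String
  /-- a-invariants `[a₁,a₂,a₃,a₄,a₆]` of the global minimal model the numeric columns refer to. -/
  ainvs : List ℤ
  /-- the conductor. -/
  conductor : ℕ
  /-- the CM discriminant `d_K` (`−4`: `ℚ(i)`, `2` ramified; `−3`: `ℚ(√−3)`, `2` inert). -/
  cmDisc : ℤ
  /-- claimed `4`-rank of `Cl(ℚ(√−param))` (congruent families; `0` otherwise). -/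
  r4 : ℕ
  /-- claimed `4`-rank of `Cl(ℚ(√−2n₀))`, `n₀` the odd part of `param` (congruent families; `0` otherwise). -/
  r4two : ℕ
  /-- `s` with `#Sel₂(E/ℚ) = 2^{dim E(ℚ)[2] + s}` (Heath-Brown's `s(D)`; `= rank + dim Ш[2]`). -/
  sel2 : ℕ
  /-- cube-sum families: `true` iff `3^{(p−1)/3} ≢ 1 (mod p)` ("`3` is not a cube mod `p`"); else `false`. -/
  cubicBit : Bool
  /-- Mordell–Weil rank (engines). -/
  rankMW : ℕ
  /-- analytic rank (engines). -/
  rankAn : ℕ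
  /-- global root number (engines). -/
  rootNumber : ℤ
  /-- `#E(ℚ)_tors`. -/
  torsion : ℕ
  /-- Tamagawa product `∏_ℓ c_ℓ`. -/
  tamagawa : ℕ
  /-- the analytic order of `Ш`, rounded (engines agree to `digits` digits that it is this integer). -/
  shaAn : ℕ
  /-- `v₂(shaAn)`. -/
  ord2ShaAn : ℕ
  /-- `dim_{𝔽₂} Ш(E)[2]` from `2`-descent (`= sel2 − rankMW`). -/
  sha2 : ℕ
  /-- `v₂` of the index `[E(ℚ) : ℤ P_K + E(ℚ)_tors]` of a Heegner point, when an engine pinned it. -/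
  ord2Heegner : Option ℕ
  /-- decimal digits to which the engines agree on `#Ш_an` (min over engines). -/
  digits : ℕ
  /-- provenance strings (engine:job); at least two. -/
  engines : List String
  deriving DecidableEq

/-! ### Kernel-evaluable helpers (the Rédei and Monsky kernel counts, the cubic bit) -/

/-- The number of vectors `v ∈ 𝔽₂^t` with `RM · v = 0` for the tree's Rédei matrix `redeiMatrix n p` on
the prime tuple read off a list (`t = l.length`). By Rédei–Reichardt this is `2 · 2^{r₄(Cl(ℚ(√−n)))}` when
`l` lists the primes of the discriminant (`RedeiReichardt.card_ker_redeiMatrix_eq_two_mul_fourTwoCard`).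
[cite: LiMa2008, Def. 0.2 and Thm. 0.4 (pp. 279–280)] -/
def redeiKerCard (n : ℕ) (l : List ℕ) : ℕ :=
  Fintype.card {v : Fin l.length → ZMod 2 // redeiMatrix n (fun i => l.get i) *ᵥ v = 0}

/-- The prime tuple of `disc ℚ(√−n)` for square-free `n` whose distinct primes are `l` (increasing, `2`
listed first when `n` is even): `(2, l…)` when `n ≡ 1 (mod 4)` (`D = −4n`), else `l` (`D = −n` for
`n ≡ 3 (mod 4)`; `D = −4n` with `2 ∈ l` for even `n`) — the tuple with `∏ = 2n` resp. `n` of the tree's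
Rédei–Reichardt statement. [cite: LiMa2008, Lemma 0.1 (p. 279)] -/
def redeiTuple (n : ℕ) (l : List ℕ) : List ℕ := if n % 4 = 1 then 2 :: l else l

/-- The matrix index for `ℚ(√−2n₀)`, `n₀` the odd part of `param`: `2·param` for odd `param`, `param`
for even `param = 2n₀`. [cite: Tian2014, Thm. 1.3 (1.1) (arXiv p. 2)] [cite: LiMa2008, Lemma 0.1 (p. 279)] -/
def redeiTwiceIndex (param : ℕ) : ℕ := if param % 2 = 1 then 2 * param else param

/-- The prime tuple of `disc ℚ(√−2n₀) = −8n₀`: `(2, primes)` for odd `param`; `primes` (which then starts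
with `2`) for even `param`. [cite: Tian2014, Thm. 1.3 (1.1) (arXiv p. 2)] [cite: LiMa2008, Lemma 0.1 (p. 279)] -/
def redeiTwiceTuple (param : ℕ) (l : List ℕ) : List ℕ := if param % 2 = 1 then 2 :: l else l

/-- Monsky's matrix `A` on a prime tuple, entries by Euler's criterion: off-diagonal `[(p_j/p_i) = −1]`,
diagonal = row sums. [cite: HeathBrown1994SelmerCongruentII, Appendix (Monsky), typescript p. 39 L13–L26] -/
def monskyA {k : ℕ} (p : Fin k → ℕ) : Matrix (Fin k) (Fin k) (ZMod 2) :=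
  Matrix.of fun i j =>
    if i = j then ∑ l ∈ Finset.univ.erase i, kroneckerBit (p l) (p i) else kroneckerBit (p j) (p i)

/-- Monsky's diagonal matrix `D_a = diag([(a/p_i) = −1])`, `a ∈ {2, −2, −1}`.
[cite: HeathBrown1994SelmerCongruentII, Appendix (Monsky), typescript p. 39 L10–L13] -/
def monskyD {k : ℕ} (p : Fin k → ℕ) (a : ℤ) : Matrix (Fin k) (Fin k) (ZMod 2) :=
  Matrix.diagonal fun i => kroneckerBit a (p i)

/-- Monsky's `2k × 2k` matrix for ODD `D = p₁⋯p_k`: `( A + D₂, D₂ ; D₂, A + D₋₂ )`.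
[cite: HeathBrown1994SelmerCongruentII, Appendix (Monsky), typescript p. 39 L27–L32] -/
def monskyOdd {k : ℕ} (p : Fin k → ℕ) : Matrix (Fin k ⊕ Fin k) (Fin k ⊕ Fin k) (ZMod 2) :=
  Matrix.fromBlocks (monskyA p + monskyD p 2) (monskyD p 2) (monskyD p 2) (monskyA p + monskyD p (-2))

/-- Monsky's matrix for EVEN `D = 2p₁⋯p_k`: `( Aᵀ + D₂, D₋₁ ; D₂, A + D₂ )`.
[cite: HeathBrown1994SelmerCongruentII, Appendix (Monsky), typescript p. 41 L20–L36] -/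
def monskyEven {k : ℕ} (p : Fin k → ℕ) : Matrix (Fin k ⊕ Fin k) (Fin k ⊕ Fin k) (ZMod 2) :=
  Matrix.fromBlocks ((monskyA p)ᵀ + monskyD p 2) (monskyD p (-1)) (monskyD p 2) (monskyA p + monskyD p 2)

/-- `#ker` of Monsky's matrix of `E_D`, `D` square-free with ODD prime list `l` (odd `D`) — `= 2^{s(D)}`
by Monsky's theorem. [cite: HeathBrown1994SelmerCongruentII, Appendix (Monsky), typescript p. 39 L1–L3 and L33] -/
def monskyKerCardOdd (l : List ℕ) : ℕ :=
  Fintype.card {v : Fin l.length ⊕ Fin l.length → ZMod 2 // monskyOdd (fun i => l.get i) *ᵥ v = 0}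

/-- `#ker` of Monsky's matrix of `E_{2D₀}`, `D₀` odd square-free with prime list `l` — `= 2^{s(2D₀)}`.
[cite: HeathBrown1994SelmerCongruentII, Appendix (Monsky), typescript p. 41 L36] -/
def monskyKerCardEven (l : List ℕ) : ℕ :=
  Fintype.card {v : Fin l.length ⊕ Fin l.length → ZMod 2 // monskyEven (fun i => l.get i) *ᵥ v = 0}

/-- The cubic-residue bit of the Sylvester families: `3^{(p−1)/3} mod p ≠ 1` (for a prime `p ≡ 1 (mod 3)`
this says `3` is NOT a cube modulo `p`; `Claim.lean` proves the implication used). [cite: DasguptaVoight2018, Thm. 2 (hypothesis)] -/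
def cubicNonResidueBit (p : ℕ) : Bool := decide (powMod 3 ((p - 1) / 3) p ≠ 1)

/-! ### The recheck -/

namespace Record

variable (r : Record)

/-- The odd primes of the record. [folklore] -/
def oddPrimes : List ℕ := r.primes.filter (· ≠ 2)

/-- Support: every listed prime is prime (`< 504100`), the list has no duplicates, is nonempty, and
`2` occurs only in first position (the odd primes follow, in the family's printed order). [folklore] -/
def checkPrimes : Bool :=
  !r.primes.isEmpty && r.primes.all isPrimeBelow504100 && decide r.primes.Nodup &&
    (r.primes.tail.all fun q => decide (q ≠ 2))

/-- The family's SHAPE of the parameter and the printed residue conditions: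
* `congruentLLT`: `param = ∏ primes` (square-free), `param ≡ 5 (mod 8)`, every prime `≡ 1 (mod 4)`;
* `congruentTian`: `param = ∏ primes ≡ 5, 6, 7 (mod 8)`; the odd primes are listed in Tian's order
  `p₀, p₁, …, p_k` with `pᵢ ≡ 1 (mod 8)` for `i ≥ 1` (no condition on `p₀`), `k + 1 ≥ 1`;
* `sylvester`: `primes = [p]`, `param = p`, `p ≡ 4, 7 (mod 9)`; `sylvesterSq`: `param = p²`, same `p`;
* `cubeSumTwoP`: `primes = [2, p]`, (`p ≡ 2 (mod 9)` and `param = 2p`) or (`p ≡ 5` and `param = 2p²`);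
* `cubeSumThreeP`: `primes = [3, p]`, (`p ≡ 2 (mod 9)` and `param = 3p²`) or (`p ≡ 5` and `param = 3p`).
[cite: LiLiuTian2024, Thm. 1.2] [cite: Tian2014, Thm. 1.3 (arXiv p. 2, L5–L8)] [cite: HuShuYin2019, Thm. 1.3]
[cite: KezukaLi2020, Cor. 1.2] [cite: ShuYin2022, Thm. 1.2] -/
def checkShape : Bool :=
  match r.family, r.primes with
  | .congruentLLT, l =>
    (l.prod == r.param) && (r.param % 8 == 5) && l.all fun q => q % 4 == 1
  | .congruentTian, l =>
    (l.prod == r.param) && (r.param % 8 == 5 || r.param % 8 == 6 || r.param % 8 == 7) &&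
      (match l.filter (· ≠ 2) with
        | [] => false
        | _ :: rest => rest.all fun q => q % 8 == 1)
  | .sylvester, [p] => (r.param == p) && (p % 9 == 4 || p % 9 == 7)
  | .sylvesterSq, [p] => (r.param == p * p) && (p % 9 == 4 || p % 9 == 7)
  | .cubeSumTwoP, [2, p] => (p % 9 == 2 && r.param == 2 * p) || (p % 9 == 5 && r.param == 2 * p * p)
  | .cubeSumThreeP, [3, p] => (p % 9 == 2 && r.param == 3 * p * p) || (p % 9 == 5 && r.param == 3 * p)
  | _, _ => false

/-- Model, conductor, CM discriminant: congruent families `ainvs = [0,0,0,−n²,0]`, `N = 32n²` (odd `n`) /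
`16n²` (even `n`), `d_K = −4`; `sylvester`: `ainvs = [0,0,p,0,−7p²]` (the tree's `X12.sylvesterCurve p`),
`d_K = −3`; the other cube-sum families: `d_K = −3`, five a-invariants (model and conductor are engine
output, two engines agreeing; no formula is rechecked — e.g. `N(E_7) = 9·7²` but `N(E_13) = 27·13²`).
[cite: LiLiuTian2024, Thm. 1.2 (the model y² = x³ − n²x)] [cite: HuShuYin2019, p. 4 (the model)] -/
def checkModel : Bool :=
  match r.family, r.primes with
  | .congruentLLT, _ | .congruentTian, _ =>
    (r.ainvs == [0, 0, 0, -((r.param : ℤ) ^ 2), 0]) && (r.cmDisc == -4) &&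
      (r.conductor == (if r.param % 2 = 1 then 32 else 16) * r.param ^ 2)
  | .sylvester, [p] => (r.ainvs == [0, 0, (p : ℤ), 0, -(7 * (p : ℤ) ^ 2)]) && (r.cmDisc == -3)
  | .sylvesterSq, _ => (r.ainvs.length == 5) && (r.cmDisc == -3)
  | _, _ => (r.ainvs.length == 5) && (r.cmDisc == -3)

/-- The class-group certificates (congruent families only): `#ker RM(disc ℚ(√−param)) = 2^{r4+1}` and
`#ker RM(disc ℚ(√−2n₀)) = 2^{r4two+1}`; and the PRINTED class-group hypothesis of the family:
`congruentLLT` ⇒ `r4 = 0`; `congruentTian` ⇒ `r4two = 0` if `n₀ ≡ ±3 (mod 8)` else `r4two = 1`.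
Vacuous (`r4 = r4two = 0` demanded) for cube-sum families.
[cite: LiMa2008, Thm. 0.4 (p. 280)] [cite: LiLiuTian2024, Thm. 1.2 (hypothesis)] [cite: Tian2014, Thm. 1.3 (1.1)] -/
def checkRedei : Bool :=
  if r.family.isCongruent then
    let n₀ := if r.param % 2 = 1 then r.param else r.param / 2
    (redeiKerCard r.param (redeiTuple r.param r.primes) == 2 ^ (r.r4 + 1)) &&
    (redeiKerCard (redeiTwiceIndex r.param) (redeiTwiceTuple r.param r.primes) == 2 ^ (r.r4two + 1)) &&
    (match r.family with
      | .congruentLLT => r.r4 == 0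
      | _ => r.r4two == (if n₀ % 8 = 3 ∨ n₀ % 8 = 5 then 0 else 1))
  else (r.r4 == 0) && (r.r4two == 0)

/-- The `2`-Selmer certificate (congruent families): `#ker` of Monsky's matrix on the odd primes (odd /
even form by the parity of `param`) `= 2^{sel2}`; no recheck for cube-sum families (engine column).
[cite: HeathBrown1994SelmerCongruentII, Appendix (Monsky), typescript p. 39 L33 and p. 41 L36] -/
def checkSelmer : Bool :=
  if r.family.isCongruent then
    (if r.param % 2 = 1 then monskyKerCardOdd r.oddPrimes else monskyKerCardEven r.oddPrimes) == 2 ^ r.sel2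
  else true

/-- The cubic-residue certificate: for `sylvester` / `sylvesterSq` the bit must be `true` AND recomputed
(`3^{(p−1)/3} mod p ≠ 1` with `p ≡ 1 (mod 3)`); for the other families it must be `false` (unused).
[cite: DasguptaVoight2018, Thm. 2 (hypothesis "3 is not a cube modulo p")] -/
def checkCubic : Bool :=
  match r.family, r.primes with
  | .sylvester, [p] | .sylvesterSq, [p] => r.cubicBit && (p % 3 == 1) && cubicNonResidueBit p
  | _, _ => !r.cubicBit

/-- Invariants and the two-engine columns, consistency only: the LEAF (`rankAn = rankMW = 1`,
`rootNumber = −1`), `0 < shaAn` a perfect square, `ord2ShaAn = v₂(shaAn)`, `sel2 = rankMW + sha2`,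
`0 < torsion`, `0 < tamagawa`, `1 ≤ digits`, at least two engines; AGAINST PRINT: `sha2 = 0` on the two
congruent families (Ш of odd order: Tian Thm. 1.3 / Li–Liu–Tian proof), `ord2ShaAn = 0` on `congruentLLT`
(full BSD). [cite: Tian2014, Thm. 1.3] [cite: LiLiuTian2024, Thm. 1.2 and proof] [cite: Miller2011LMS, Def. 1.1] -/
def checkInvariants : Bool :=
  (r.rankAn == 1) && (r.rankMW == 1) && (r.rootNumber == -1) && decide (0 < r.shaAn) &&
  (Nat.sqrt r.shaAn * Nat.sqrt r.shaAn == r.shaAn) && (r.ord2ShaAn == natVal 2 r.shaAn) &&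
  (r.sel2 == r.rankMW + r.sha2) && decide (0 < r.torsion) && decide (0 < r.tamagawa) &&
  decide (1 ≤ r.digits) && decide (2 ≤ r.engines.length) &&
  (!r.family.isCongruent || r.sha2 == 0) &&
  (!(r.family == .congruentLLT) || r.ord2ShaAn == 0)

/-- The full recheck of a record (conjunction of the seven checks above). [folklore] -/
def check : Bool :=
  r.checkPrimes && r.checkShape && r.checkModel && r.checkRedei && r.checkSelmer && r.checkCubic &&
    r.checkInvariants

end Record

/-- A list of records is `Certified` when every one passes `Record.check`; the statement of each display
theorem `theorem certified… : Certified [ … ] := by decide` of the files `Records*.lean`. An `abbrev` of a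
`Bool` equation (decidable by unfolding; no instance declared). [cite: Miller2011LMS, §1 and Def. 1.1 (certificates for BSD(E,p))] -/
abbrev Certified (rs : List Record) : Prop := rs.all Record.check = true

/-- Unpacking `Certified`: every listed record passes the recheck. [cite: Miller2011LMS, §1 and Def. 1.1] -/
theorem Certified.check_of_mem {rs : List Record} (h : Certified rs) {r : Record} (hr : r ∈ rs) :
    r.check = true :=
  List.all_eq_true.1 h r hr

namespace Record

variable (r : Record)

/-- Projection of a passing recheck: the prime-list check holds. [cite: LiLiuTian2024, Thm. 1.2 (hypothesis: square-free n)] -/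
theorem checkPrimes_of_check (h : r.check = true) : r.checkPrimes = true := by
  simp only [check, Bool.and_eq_true] at h; exact h.1.1.1.1.1.1

/-- Projection: the shape check holds. [cite: LiLiuTian2024, Thm. 1.2 (hypotheses)] [cite: Tian2014, Thm. 1.3 (hypotheses)] -/
theorem checkShape_of_check (h : r.check = true) : r.checkShape = true := by
  simp only [check, Bool.and_eq_true] at h; exact h.1.1.1.1.1.2

/-- Projection: the model check holds. [cite: LiLiuTian2024, Thm. 1.2 (the model y² = x³ − n²x)] -/
theorem checkModel_of_check (h : r.check = true) : r.checkModel = true := by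
  simp only [check, Bool.and_eq_true] at h; exact h.1.1.1.1.2

/-- Projection: the Rédei check holds. [cite: LiMa2008, Thm. 0.4 (p. 280)] -/
theorem checkRedei_of_check (h : r.check = true) : r.checkRedei = true := by
  simp only [check, Bool.and_eq_true] at h; exact h.1.1.1.2

/-- Projection: the Selmer check holds. [cite: HeathBrown1994SelmerCongruentII, Appendix (Monsky), typescript p. 39 L33] -/
theorem checkSelmer_of_check (h : r.check = true) : r.checkSelmer = true := by
  simp only [check, Bool.and_eq_true] at h; exact h.1.1.2

/-- Projection: the cubic check holds. [cite: DasguptaVoight2018, Thm. 2 (hypothesis)] -/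
theorem checkCubic_of_check (h : r.check = true) : r.checkCubic = true := by
  simp only [check, Bool.and_eq_true] at h; exact h.1.2

/-- Projection: the invariants check holds. [cite: Miller2011LMS, Def. 1.1] -/
theorem checkInvariants_of_check (h : r.check = true) : r.checkInvariants = true := by
  simp only [check, Bool.and_eq_true] at h; exact h.2

end Record

/-! ### Sample and tamper test

The numeric columns of the sample are those of the display file `RecordsCongruentLLT.lean` (engines
P = PARI/GP, S = SageMath; kit jobs named there). -/

/-- SAMPLE (and regression test of the recheck): the record of `E_5 : y² = x³ − 25x` (`800a1`; `n = 5`,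
the first Li–Liu–Tian member: `5 ≡ 5 (mod 8)` prime, `Cl(ℚ(√−5)) ≅ ℤ/2` so `r₄ = 0`; `Cl(ℚ(√−10)) ≅ ℤ/2`,
`r₄ = 0` = Tian's (1.1) for `n ≡ 5 (mod 8)`; Monsky `s(5) = 1`; rank `1`, `#Ш_an = 1`, `#E(ℚ)_tors = 4`,
`∏ c_ℓ = 8`) passes. [cite: LiLiuTian2024, Thm. 1.2 ("in particular" clause, p = 5)] -/
theorem certified_sample : Certified [
  { family := .congruentLLT, param := 5, primes := [5], label := "800a1", ainvs := [0, 0, 0, -25, 0],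
    conductor := 800, cmDisc := -4, r4 := 0, r4two := 0, sel2 := 1, cubicBit := false, rankMW := 1,
    rankAn := 1, rootNumber := -1, torsion := 4, tamagawa := 8, shaAn := 1, ord2ShaAn := 0, sha2 := 0,
    ord2Heegner := none, digits := 10, engines := ["P:PARI-2.17.3 j278947", "S:SageMath j278949"] } ] := by
  decide +kernel

/-- Tampering is caught: the same record with `r4 := 1` (claiming an ideal class of order `4` in
`Cl(ℚ(√−5))`) fails — the kernel recomputes the Rédei kernel of `(2, 5)` as `2 ≠ 4`, and `r4 ≠ 0` is
anyway not a Li–Liu–Tian member. [cite: LiMa2008, Thm. 0.4 (p. 280)] -/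
theorem not_certified_tampered : ¬ Certified [
  { family := .congruentLLT, param := 5, primes := [5], label := "800a1", ainvs := [0, 0, 0, -25, 0],
    conductor := 800, cmDisc := -4, r4 := 1, r4two := 0, sel2 := 1, cubicBit := false, rankMW := 1,
    rankAn := 1, rootNumber := -1, torsion := 4, tamagawa := 8, shaAn := 1, ord2ShaAn := 0, sha2 := 0,
    ord2Heegner := none, digits := 10, engines := [] } ] := by
  decide +kernel

end Literature.NumberTheory.EllipticCurves.Rank1Residual.CornerFTwoCertificates
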